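import Literature.AlgebraicGeometry.Resolution.ArithmeticalThreefoldsLocalReductionCJS
import HarnessLib

/-!
# Descent below the ramification field, assembled from its two printed steps ([CoP1] Prop. 9.5)

Topic: `Literature/AlgebraicGeometry/Resolution`. PROOF side of `CossartPiltant2019ReductionP`
(`ArithmeticalThreefoldsLocal.lean`). The one transfer input of
`cossartPiltant2019ReductionP_of_cjs_of_descent` (`ArithmeticalThreefoldsLocalReductionCJS.lean`)
that is not yet a theorem of the tree is (C4), descent of local uniformization below the
ramification field: for `M ≤ K′ ≤ Mʳ` (the ramification field of the valuation in a finite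
Galois `N | M`), `(LU K′) ⇒ (LU M)`. Its printed proof is [CoP1] Prop. 9.5 (HAL numbering;
journal Prop. 9.3), which is a pure ASSEMBLY of

* [CoP1] Cor. 6.3 — ascent to the inertia field (`exists_model_inertiaField_of_cofinal`,
  `ArithmeticalThreefoldsLocalUnramifiedClimb.lean`, PROVED modulo cofinality);
* [CoP1] Lemma 6.1 (1) — `Kⁱ·K′` is the inertia field of the valuation over `K′`;
* (8)/Zariski–Samuel VI §12 — `Kʳ | Kⁱ` is abelian of order prime to `p`, whence a tower of
  Galois extensions of prime degrees `ℓ ≠ p` from `Kⁱ` up to `Kⁱ·K′`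
  (`isPrimeGaloisTower_fixedField`, `AbelianPrimeGaloisTower.lean`);
* [CoP1] Lemma 9.4 — ONE STEP of tame descent: `(LU B) ⇒ (LU A)` for a Galois step `A ≤ B`
  of prime degree `ℓ ≠ p` ("by successive applications of lemma 9.4, `Vⁱ/k` has a local
  uniformization");
* [CoP1] Prop. 9.3 — UNRAMIFIED descent: `(LU K′) ⇒ (LU M)` for `M ≤ K′ ≤ Mⁱ` ("the conclusion
  then follows from proposition 9.3").

This file proves the assembly in the climbing frame of the reduction, leaving exactly the two
analytic steps, Lemma 9.4 (`hStep`) and Prop. 9.3 (`hUnram`), as hypotheses — so that (C4), an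
`L–XL` input in the census of the `CleanModels` crux memos, is now TWO typed inputs, each the
statement of one printed result:

* `IsPrimeGaloisTower.induction_down` — PROVED: downward induction along a prime Galois tower;
* `lift_fixedField_inertiaGroupIn_extendScalars_eq` — PROVED: [CoP1] Lemma 6.1 (1) for the
  inertia group, as an equality of subfields of the ambient field after rebasing
  (`TameTowerRebase.lean`, `AbelianPrimeGaloisTower.lean`);
* `isPrimeGaloisTower_inertiaField_inf_fixingSubgroup` — PROVED: the tower `Mⁱ ⊆ ⋯ ⊆ Mⁱ·K′`;
* `descent_below_ramificationField_of_steps` — PROVED: **(C4) from cofinality, Lemma 9.4 and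
  Prop. 9.3** (all three at every subfield `∋ S` of the ambient valued field);
* `cossartPiltant2019ReductionP_of_cjs_of_steps` — PROVED:
  `CossartPiltant2019Local → CossartPiltant2019Principalization → CossartJannsenSaito2020General →
  (embedded resolution of surfaces) → (Lemma 9.4) → (Prop. 9.3) → CossartPiltant2019ReductionP`.

Everything is PROVED; no named facts are introduced (the local theorem, principalization,
resolution of surfaces, Lemma 9.4 and Prop. 9.3 enter as hypotheses). What is deliberately NOT
here: proofs of Lemma 9.4 (its toric core for `σ`-STABLE models is
`exists_fixed_model_isRegularLocalRing`, `TameCyclicToricDescentModels.lean`; the reduction of an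
arbitrary local uniformization to a stable one is open in the tree) and of Prop. 9.3
(henselization density and Zariski's Main Theorem).

## Sources

* V. Cossart, O. Piltant, *Resolution of singularities of threefolds in positive
  characteristic. I*, J. Algebra 320 (2008) 1051–1082: Lemma 6.1, Cor. 6.3, Prop. 9.3,
  Lemma 9.4, Prop. 9.5 and its proof (HAL hal-00139124, pp. 17–18, 26–30). [CossartPiltant2008]
* V. Cossart, O. Piltant, J. Algebra 529 (2019) 268–535 = arXiv:1412.0868, proof of Prop. 4.10
  (arXiv v1: Prop. 4.8, p. 54: "Proving that `(LU vⁱ)`, then `(LU v)` hold is an easy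
  adaptation of [CoP1] proposition 9.3"). [CossartPiltant2019]
* O. Zariski, P. Samuel, *Commutative Algebra* II, Ch. VI §12, (23) and Thm. 25, pp. 76–78.
  [ZariskiSamuel1960]
-/

noncomputable section

open CategoryTheory AlgebraicGeometry TopologicalSpace IsLocalRing _root_.Polynomial
  _root_.IntermediateField

namespace Literature.AlgebraicGeometry.Resolution

universe u

/-! ## Towers: downward induction and the inertia field over an intermediate base -/

section Towers

variable {Ω : Type u} [Field Ω]

/-- Downward induction along a prime Galois tower `A ⊆ ⋯ ⊆ B`: a property of subfields that
DESCENDS along every step of the tower lying between `A₀ ≤ A` and `B` passes from `B` to `A`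
("by successive applications of lemma 9.4"). [cite: CossartPiltant2008, proof of Prop. 9.5 (HAL p. 30)] -/
theorem IsPrimeGaloisTower.induction_down {p : ℕ} {A₀ B : Subfield Ω} (P : Subfield Ω → Prop)
    (hstep : ∀ M M₁ : Subfield Ω, A₀ ≤ M → M₁ ≤ B → IsPrimeGaloisStep p M M₁ → P M₁ → P M)
    {A : Subfield Ω} (hA : A₀ ≤ A) (h : IsPrimeGaloisTower p A B) (hPB : P B) : P A := by
  induction h with
  | refl M => exact hPB
  | step hs ht ih =>
    exact hstep _ _ hA ht.le hs (ih hstep (hA.trans hs.le) hPB)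

variable {M : Subfield Ω} (N : IntermediateField M Ω)

/-- **[CoP1] Lemma 6.1 (1) for the inertia group, inside `Ω`**: for `N | M` finite Galois with
valuation ring `V ∩ N` and an intermediate field `L′`, the inertia field of `N` over `L′`
(computed in the Galois group of `N` over `lift L′`, after rebasing with `TameTowerRebase.lean`)
is the fixed field of `G_T(N|M) ∩ Gal(N|L′)` ("`Gⁱ(S/R′) = Gⁱ(S/R) ∩ Gal(L/K′)`": the
defining conditions of `G_T` do not mention the base field).
[cite: CossartPiltant2008, Lemma 6.1 (1) (HAL p. 17)] -/
theorem lift_fixedField_inertiaGroupIn_extendScalars_eq (V : ValuationSubring Ω)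
    [FiniteDimensional M N] [IsGalois M N] (L' : IntermediateField M N) :
    (lift (fixedField (inertiaGroupIn V
        (Subfield.extendScalars (lift_toSubfield_le L'))))).toSubfield =
      (lift (fixedField (inertiaGroupIn V N ⊓ L'.fixingSubgroup))).toSubfield := by
  classical
  obtain ⟨ψ, hψ⟩ := exists_rebaseAutEquiv L'
  -- the inertia condition transfers along `ψ`
  have key : ∀ σ, σ ∈ inertiaGroupIn V (Subfield.extendScalars (lift_toSubfield_le L')) ↔
      ((ψ σ : L'.fixingSubgroup) : N ≃ₐ[M] N) ∈ inertiaGroupIn V N := by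
    intro σ
    rw [mem_inertiaGroupIn_iff, mem_inertiaGroupIn_iff]
    constructor
    · rintro ⟨h1, h2⟩
      refine ⟨fun y => ?_, fun y hy => ?_⟩
      · rw [hψ σ y]
        exact h1 ⟨(y : Ω), (mem_extendScalars_lift_iff L' y).mpr y.2⟩
      · rw [hψ σ y]
        exact h2 ⟨(y : Ω), (mem_extendScalars_lift_iff L' y).mpr y.2⟩ hy
    · rintro ⟨h1, h2⟩
      refine ⟨fun y => ?_, fun y hy => ?_⟩
      · have hyN : (y : Ω) ∈ N := (mem_extendScalars_lift_iff L' y).mp y.2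
        have h := h1 ⟨y, hyN⟩
        rw [hψ σ ⟨y, hyN⟩] at h
        exact h
      · have hyN : (y : Ω) ∈ N := (mem_extendScalars_lift_iff L' y).mp y.2
        have h := h2 ⟨y, hyN⟩ hy
        rw [hψ σ ⟨y, hyN⟩] at h
        exact h
  ext x
  constructor
  · intro hx
    have hxN' : x ∈ Subfield.extendScalars (lift_toSubfield_le L') :=
      IntermediateField.lift_le _ hx
    have hxN : x ∈ N := (mem_extendScalars_lift_iff L' x).mp hxN'
    have hx' := (IntermediateField.mem_lift
      (⟨x, hxN'⟩ : Subfield.extendScalars (lift_toSubfield_le L'))).mp hx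
    rw [IntermediateField.mem_fixedField_iff] at hx'
    refine (IntermediateField.mem_lift (⟨x, hxN⟩ : N)).mpr ?_
    rw [IntermediateField.mem_fixedField_iff]
    intro τ hτ
    obtain ⟨hτi, hτU⟩ := Subgroup.mem_inf.mp hτ
    set σ := ψ.symm ⟨τ, hτU⟩ with hσ
    have hψσ : ((ψ σ : L'.fixingSubgroup) : N ≃ₐ[M] N) = τ := by
      rw [hσ, MulEquiv.apply_symm_apply]
    have hσi : σ ∈ inertiaGroupIn V (Subfield.extendScalars (lift_toSubfield_le L')) :=
      (key σ).mpr (by rw [hψσ]; exact hτi)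
    have hfix := hx' σ hσi
    apply Subtype.ext
    change ((τ ⟨x, hxN⟩ : N) : Ω) = x
    rw [← hψσ, hψ σ ⟨x, hxN⟩]
    exact congrArg Subtype.val hfix
  · intro hx
    have hxN : x ∈ N := IntermediateField.lift_le _ hx
    have hx' : (⟨x, hxN⟩ : N) ∈ fixedField (inertiaGroupIn V N ⊓ L'.fixingSubgroup) :=
      (IntermediateField.mem_lift (⟨x, hxN⟩ : N)).mp hx
    rw [IntermediateField.mem_fixedField_iff] at hx'
    have hxN' : x ∈ Subfield.extendScalars (lift_toSubfield_le L') :=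
      (mem_extendScalars_lift_iff L' x).mpr hxN
    refine (IntermediateField.mem_lift
      (⟨x, hxN'⟩ : Subfield.extendScalars (lift_toSubfield_le L'))).mpr ?_
    rw [IntermediateField.mem_fixedField_iff]
    intro σ hσ
    have hψσ : ((ψ σ : L'.fixingSubgroup) : N ≃ₐ[M] N) ∈
        inertiaGroupIn V N ⊓ L'.fixingSubgroup :=
      Subgroup.mem_inf.mpr ⟨(key σ).mp hσ, (ψ σ).2⟩
    have hfix := hx' _ hψσ
    have h1 : (((ψ σ : L'.fixingSubgroup) : N ≃ₐ[M] N) ⟨x, hxN⟩ : Ω) = (σ ⟨x, hxN'⟩ : Ω) :=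
      hψ σ ⟨x, hxN⟩
    apply Subtype.ext
    change (σ ⟨x, hxN'⟩ : Ω) = x
    rw [← h1, hfix]

/-- `K′ = lift L′ ≤ Mʳ` forces `Gʳ ≤ Gal(N | L′)` (Galois correspondence). [folklore] -/
private theorem ramificationGroupIn_le_fixingSubgroup_of_le (V : ValuationSubring Ω)
    [FiniteDimensional M N] [IsGalois M N] (L' : IntermediateField M N)
    (h : (lift L').toSubfield ≤ (lift (fixedField (ramificationGroupIn V N))).toSubfield) :
    ramificationGroupIn V N ≤ L'.fixingSubgroup := by
  have hL' : L' ≤ fixedField (ramificationGroupIn V N) := by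
    intro x hx
    have h1 : (x : Ω) ∈ (lift L').toSubfield := (IntermediateField.mem_lift x).mpr hx
    exact (IntermediateField.mem_lift x).mp (h h1)
  exact (IntermediateField.le_iff_le _ _).mp hL'

/-- **The tame tower `Mⁱ ⊆ ⋯ ⊆ Mⁱ·K′`** for `K′ = lift L′ ≤ Mʳ`: the fixed field of
`G_T ∩ Gal(N|L′)` is reached from the inertia field `N^{G_T}` by a tower of Galois extensions of
prime degrees `ℓ ≠ p` — `G_T ∩ Gal(N|L′)` contains `G_V ⊇ [G_T, G_T]` and its index in `G_T`
divides `(G_T : G_V)`, which is prime to `p` ("`Kʳ/Kⁱ` is an Abelian extension of order prime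
to `p`, `K″/Kⁱ` is a tower of Abelian extensions of prime degrees `lᵢ ≠ p`").
[cite: CossartPiltant2008, proof of Prop. 9.5 (HAL p. 30)]
[cite: ZariskiSamuel1960, Ch. VI §12 (23), p. 76] -/
theorem isPrimeGaloisTower_inertiaField_inf_fixingSubgroup (V : ValuationSubring Ω) {p : ℕ}
    [Fact p.Prime] [CharP (ResidueField V) p] [FiniteDimensional M N] [IsGalois M N]
    (L' : IntermediateField M N)
    (h : (lift L').toSubfield ≤ (lift (fixedField (ramificationGroupIn V N))).toSubfield) :
    IsPrimeGaloisTower p (lift (fixedField (inertiaGroupIn V N))).toSubfield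
      (lift (fixedField (inertiaGroupIn V N ⊓ L'.fixingSubgroup))).toSubfield := by
  have hGr : ramificationGroupIn V N ≤ L'.fixingSubgroup :=
    ramificationGroupIn_le_fixingSubgroup_of_le N V L' h
  have hGrB : ramificationGroupIn V N ≤ inertiaGroupIn V N ⊓ L'.fixingSubgroup :=
    le_inf (ramificationGroupIn_le_inertiaGroupIn V N) hGr
  refine isPrimeGaloisTower_fixedField p _ (inertiaGroupIn V N)
    (inertiaGroupIn V N ⊓ L'.fixingSubgroup) inf_le_left ?_ ?_ rfl
  · intro s hs t ht
    exact hGrB (commutator_mem_ramificationGroupIn V N hs ht)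
  · intro hdvd
    have h1 : (inertiaGroupIn V N ⊓ L'.fixingSubgroup).relIndex (inertiaGroupIn V N) ∣
        (ramificationGroupIn V N).relIndex (inertiaGroupIn V N) :=
      Subgroup.relIndex_dvd_of_le_left _ hGrB
    have h2 : p ∣ (ramificationGroupIn V N).relIndex (inertiaGroupIn V N) := hdvd.trans h1
    have hcop := coprime_index_ramificationGroupIn V N (p := p)
    rw [← Subgroup.relIndex] at hcop
    exact (Nat.Prime.coprime_iff_not_dvd Fact.out).mp hcop h2

end Towers

/-! ## (C4) from Lemma 9.4 and Prop. 9.3 -/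

section Assembly

variable {S E : Type u} [CommRing S] [IsRegularLocalRing S] [Field E] [Algebra S E]

/-- **[CoP1] Prop. 9.5 as an assembly: descent below the ramification field from ONE STEP of
tame descent (Lemma 9.4) and unramified descent (Prop. 9.3).** Frame: `S` local of residue
characteristic `p` in an ambient valued field `(E, O_E)` dominating it; `(LU X)` for a subfield
`X ∋ S` means a model `S[t] ⊆ O_E`, `t ⊆ X ⊆ Frac(S)(t)`, regular at the centre. Hypotheses, at
every subfield `∋ S`: cofinality of local uniformizations (`hCOF`, [CoP1] Cor. 4.6), one step of
tame descent (`hStep`: `(LU B) ⇒ (LU A)` for a Galois step `A ≤ B` of prime degree `ℓ ≠ p`,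
[CoP1] Lemma 9.4) and unramified descent (`hUnram`: `(LU K′) ⇒ (LU M)` for `M ≤ K′ ≤ Mⁱ`,
[CoP1] Prop. 9.3). Claim: `(LU K′) ⇒ (LU M)` for `M ≤ K′ ≤ Mʳ`. Proof (HAL p. 30): `K″ :=
Kⁱ·K′` is the inertia field of the valuation over `K′` (Lemma 6.1 (1),
`lift_fixedField_inertiaGroupIn_extendScalars_eq`), so `(LU K″)` by the unramified ascent
`exists_model_inertiaField_of_cofinal` (Cor. 6.3); `K″ | Kⁱ` is a tower of Galois extensions of
prime degrees `ℓᵢ ≠ p` (`isPrimeGaloisTower_inertiaField_inf_fixingSubgroup`), descended step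
by step by `hStep`; finally `(LU Kⁱ) ⇒ (LU M)` by `hUnram`.
[cite: CossartPiltant2008, Prop. 9.5 and its proof (HAL p. 30)]
[cite: CossartPiltant2019, proof of Prop. 4.10 (arXiv v1: Prop. 4.8, p. 54)] -/
theorem descent_below_ramificationField_of_steps
    (p : ℕ) (hp : p.Prime) (hSchar : CharP (ResidueField S) p)
    (OE : ValuationSubring E) (hSO : ∀ s : S, algebraMap S E s ∈ OE)
    (hdom : ∀ s ∈ maximalIdeal S, OE.valuation (algebraMap S E s) < 1)
    (hCOF : ∀ (M : Subfield E), (∀ s : S, algebraMap S E s ∈ M) →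
      ∀ (t : Finset E), (t : Set E) ⊆ M →
        M ≤ Subfield.closure (Set.range (algebraMap S E) ∪ (t : Set E)) →
      ∀ (hTO : (Algebra.adjoin S (t : Set E)).toSubring ≤ OE.toSubring),
        IsRegularLocalRing (Localization.AtPrime
          (Ideal.comap (Subring.inclusion hTO) (maximalIdeal OE))) →
      ∀ (c : Finset E), (c : Set E) ⊆ M → (∀ x ∈ c, x ∈ OE) →
      ∃ t' : Finset E, (t' : Set E) ⊆ M ∧
        M ≤ Subfield.closure (Set.range (algebraMap S E) ∪ (t' : Set E)) ∧
        ∃ hTO' : (Algebra.adjoin S (t' : Set E)).toSubring ≤ OE.toSubring,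
          IsRegularLocalRing (Localization.AtPrime
            (Ideal.comap (Subring.inclusion hTO') (maximalIdeal OE))) ∧
          ∀ x ∈ c, ∃ a s : E, a ∈ Algebra.adjoin S (t' : Set E) ∧
            s ∈ Algebra.adjoin S (t' : Set E) ∧ OE.valuation s = 1 ∧ x * s = a)
    (hStep : ∀ (A B : Subfield E), (∀ s : S, algebraMap S E s ∈ A) → IsPrimeGaloisStep p A B →
      (∃ t : Finset E, (t : Set E) ⊆ B ∧
        B ≤ Subfield.closure (Set.range (algebraMap S E) ∪ (t : Set E)) ∧
        ∃ hTO : (Algebra.adjoin S (t : Set E)).toSubring ≤ OE.toSubring,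
          IsRegularLocalRing (Localization.AtPrime
            (Ideal.comap (Subring.inclusion hTO) (maximalIdeal OE)))) →
      (∃ t : Finset E, (t : Set E) ⊆ A ∧
        A ≤ Subfield.closure (Set.range (algebraMap S E) ∪ (t : Set E)) ∧
        ∃ hTO : (Algebra.adjoin S (t : Set E)).toSubring ≤ OE.toSubring,
          IsRegularLocalRing (Localization.AtPrime
            (Ideal.comap (Subring.inclusion hTO) (maximalIdeal OE)))))
    (hUnram : ∀ (M : Subfield E), (∀ s : S, algebraMap S E s ∈ M) →
      ∀ (N : IntermediateField M E) [FiniteDimensional M N] [IsGalois M N] (K' : Subfield E),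
        M ≤ K' → K' ≤ (lift (fixedField (inertiaGroupIn OE N))).toSubfield →
        (∃ t : Finset E, (t : Set E) ⊆ K' ∧
          K' ≤ Subfield.closure (Set.range (algebraMap S E) ∪ (t : Set E)) ∧
          ∃ hTO : (Algebra.adjoin S (t : Set E)).toSubring ≤ OE.toSubring,
            IsRegularLocalRing (Localization.AtPrime
              (Ideal.comap (Subring.inclusion hTO) (maximalIdeal OE)))) →
        (∃ t : Finset E, (t : Set E) ⊆ M ∧
          M ≤ Subfield.closure (Set.range (algebraMap S E) ∪ (t : Set E)) ∧
          ∃ hTO : (Algebra.adjoin S (t : Set E)).toSubring ≤ OE.toSubring,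
            IsRegularLocalRing (Localization.AtPrime
              (Ideal.comap (Subring.inclusion hTO) (maximalIdeal OE)))))
    (M : Subfield E) (hSM : ∀ s : S, algebraMap S E s ∈ M)
    (N : IntermediateField M E) [FiniteDimensional M N] [IsGalois M N] (K' : Subfield E)
    (hMK' : M ≤ K') (hK'r : K' ≤ (lift (fixedField (ramificationGroupIn OE N))).toSubfield)
    (hLUK' : ∃ t : Finset E, (t : Set E) ⊆ K' ∧
      K' ≤ Subfield.closure (Set.range (algebraMap S E) ∪ (t : Set E)) ∧
      ∃ hTO : (Algebra.adjoin S (t : Set E)).toSubring ≤ OE.toSubring,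
        IsRegularLocalRing (Localization.AtPrime
          (Ideal.comap (Subring.inclusion hTO) (maximalIdeal OE)))) :
    ∃ t : Finset E, (t : Set E) ⊆ M ∧
      M ≤ Subfield.closure (Set.range (algebraMap S E) ∪ (t : Set E)) ∧
      ∃ hTO : (Algebra.adjoin S (t : Set E)).toSubring ≤ OE.toSubring,
        IsRegularLocalRing (Localization.AtPrime
          (Ideal.comap (Subring.inclusion hTO) (maximalIdeal OE))) := by
  classical
  haveI : Fact p.Prime := ⟨hp⟩
  haveI : CharP (ResidueField OE) p :=
    charP_residueField_valuationSubring_of_dominates OE p hSchar hSO hdom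
  -- `K′` as an intermediate field `L′` of `N | M`
  have hK'N : K' ≤ N.toSubfield := hK'r.trans (lift_toSubfield_le _)
  obtain ⟨L', hL', -⟩ := exists_intermediateField_lift_toSubfield_eq N K' hMK' hK'N
  subst hL'
  haveI := finiteDimensional_extendScalars_lift L'
  haveI := isGalois_extendScalars_lift L'
  have hSK' : ∀ s : S, algebraMap S E s ∈ (lift L').toSubfield := fun s => hMK' (hSM s)
  /- Step 1 (Cor. 6.3): `(LU K′) ⇒ (LU K″)`, `K″` the inertia field of the valuation over `K′` -/
  have hLUI := exists_model_inertiaField_of_cofinal OE (lift L').toSubfield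
    (Subfield.extendScalars (lift_toSubfield_le L')) (fun M' hM' => hCOF M' (by
      rcases hM' with rfl | rfl
      · exact hSK'
      · intro s
        exact le_lift_toSubfield _ (hSK' s))) hLUK'
  -- Lemma 6.1 (1): `K″ = N^{G_T ∩ Gal(N|L′)}`
  rw [lift_fixedField_inertiaGroupIn_extendScalars_eq N OE L'] at hLUI
  /- Step 2 (Lemma 9.4, repeatedly): down the tame tower `Mⁱ ⊆ ⋯ ⊆ K″` -/
  have htower := isPrimeGaloisTower_inertiaField_inf_fixingSubgroup N OE (p := p) L' hK'r
  have hSMi : ∀ s : S, algebraMap S E s ∈ (lift (fixedField (inertiaGroupIn OE N))).toSubfield :=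
    fun s => le_lift_toSubfield _ (hSM s)
  have hLUMi : ∃ t : Finset E,
      (t : Set E) ⊆ (lift (fixedField (inertiaGroupIn OE N))).toSubfield ∧
      (lift (fixedField (inertiaGroupIn OE N))).toSubfield ≤
        Subfield.closure (Set.range (algebraMap S E) ∪ (t : Set E)) ∧
      ∃ hTO : (Algebra.adjoin S (t : Set E)).toSubring ≤ OE.toSubring,
        IsRegularLocalRing (Localization.AtPrime
          (Ideal.comap (Subring.inclusion hTO) (maximalIdeal OE))) :=
    IsPrimeGaloisTower.induction_down
      (A₀ := (lift (fixedField (inertiaGroupIn OE N))).toSubfield)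
      (B := (lift (fixedField (inertiaGroupIn OE N ⊓ L'.fixingSubgroup))).toSubfield)
      (fun X => ∃ t : Finset E, (t : Set E) ⊆ X ∧
        X ≤ Subfield.closure (Set.range (algebraMap S E) ∪ (t : Set E)) ∧
        ∃ hTO : (Algebra.adjoin S (t : Set E)).toSubring ≤ OE.toSubring,
          IsRegularLocalRing (Localization.AtPrime
            (Ideal.comap (Subring.inclusion hTO) (maximalIdeal OE))))
      (fun A B hA _ hstep hLUB => hStep A B (fun s => hA (hSMi s)) hstep hLUB)
      le_rfl htower hLUI
  /- Step 3 (Prop. 9.3): `(LU Mⁱ) ⇒ (LU M)` -/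
  exact hUnram M hSM N _ (le_lift_toSubfield _) le_rfl hLUMi

end Assembly

/-! ## The reduction with (C4) split into its two printed steps -/

/-- **Cossart–Piltant 2019, Prop. 4.10 from Thm. 1.5, principalization, resolution of excellent
surfaces (embedded and non-embedded), one step of tame descent and unramified descent**:
`cossartPiltant2019ReductionP_of_cjs_of_descent` with its input (C4) ([CoP1] Prop. 9.5)
assembled by `descent_below_ramificationField_of_steps` from [CoP1] Lemma 9.4 (`hStep`: tame
descent along one Galois step of prime degree `ℓ ≠ p`) and [CoP1] Prop. 9.3 (`hUnram`: descent
below the inertia field), both for rank-one valuations of an algebraically closed valued field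
dominating the complete regular local base `S` with algebraic residue field extension — the
remaining analytic inputs of the printed reduction `Thm. 1.5 ⇒ Thm. 1.1` besides the local
theorem, principalization (Prop. 4.4) and resolution of surfaces (CJS 2020 Thm. 1.2, Cor. 1.5).
[cite: CossartPiltant2019, Props. 4.3, 4.4 and proof of Prop. 4.10 (arXiv v1: Props. 4.2, 4.3, 4.8, pp. 50–54)]
[cite: CossartPiltant2008, Lemma 9.4, Prop. 9.3, Prop. 9.5 (HAL pp. 26–30)]
[cite: CossartJannsenSaito2020, Thm. 1.2, Cor. 1.5] -/
theorem cossartPiltant2019ReductionP_of_cjs_of_steps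
    (hloc : CossartPiltant2019Local.{u}) (h44 : CossartPiltant2019Principalization.{u})
    (hCJS : CossartJannsenSaito2020General.{u})
    (hEmb : ∀ (Z : Scheme.{u}) [IsIntegral Z] [IsNoetherian Z], Scheme.IsRegular Z →
      Scheme.IsExcellent Z → ∀ (X : Set Z), IsClosed X → X ≠ Set.univ → topologicalKrullDim X ≤ 2 →
        ∃ (Z' : Scheme.{u}) (π : Z' ⟶ Z), IsProper π ∧ Function.Surjective π.base ∧
          (∃ U : Z.Opens, (U : Set Z) = Xᶜ ∧ IsIso (π ∣_ U)) ∧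
          IsStrictNormalCrossingsDivisor Z' (π.base ⁻¹' X))
    (hStep :
      ∀ (p : ℕ), p.Prime →
      ∀ (S : Type u) [CommRing S] [IsDomain S] [IsRegularLocalRing S],
        IsExcellentRing S → ringKrullDim S = 3 → CharP (ResidueField S) p →
        IsAdicComplete (maximalIdeal S) S →
      ∀ (E : Type u) [Field E] [Algebra S E], Function.Injective (algebraMap S E) →
        IsAlgClosed E → Algebra.IsAlgebraic S E →
      ∀ (OE : ValuationSubring E), (∀ s : S, algebraMap S E s ∈ OE) →
        (∀ s ∈ maximalIdeal S, OE.valuation (algebraMap S E s) < 1) →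
        (∀ y : OE, ∃ q : S[X], (∃ i, q.coeff i ∉ maximalIdeal S) ∧
          OE.valuation (q.eval₂ (algebraMap S E) y) < 1) →
      Nonempty OE.valuation.RankOne →
      ∀ (A B : Subfield E), (∀ s : S, algebraMap S E s ∈ A) → IsPrimeGaloisStep p A B →
        (∃ t : Finset E, (t : Set E) ⊆ B ∧
          B ≤ Subfield.closure (Set.range (algebraMap S E) ∪ (t : Set E)) ∧
          ∃ hTO : (Algebra.adjoin S (t : Set E)).toSubring ≤ OE.toSubring,
            IsRegularLocalRing (Localization.AtPrime
              (Ideal.comap (Subring.inclusion hTO) (maximalIdeal OE)))) →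
        (∃ t : Finset E, (t : Set E) ⊆ A ∧
          A ≤ Subfield.closure (Set.range (algebraMap S E) ∪ (t : Set E)) ∧
          ∃ hTO : (Algebra.adjoin S (t : Set E)).toSubring ≤ OE.toSubring,
            IsRegularLocalRing (Localization.AtPrime
              (Ideal.comap (Subring.inclusion hTO) (maximalIdeal OE)))))
    (hUnram :
      ∀ (p : ℕ), p.Prime →
      ∀ (S : Type u) [CommRing S] [IsDomain S] [IsRegularLocalRing S],
        IsExcellentRing S → ringKrullDim S = 3 → CharP (ResidueField S) p →
        IsAdicComplete (maximalIdeal S) S →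
      ∀ (E : Type u) [Field E] [Algebra S E], Function.Injective (algebraMap S E) →
        IsAlgClosed E → Algebra.IsAlgebraic S E →
      ∀ (OE : ValuationSubring E), (∀ s : S, algebraMap S E s ∈ OE) →
        (∀ s ∈ maximalIdeal S, OE.valuation (algebraMap S E s) < 1) →
        (∀ y : OE, ∃ q : S[X], (∃ i, q.coeff i ∉ maximalIdeal S) ∧
          OE.valuation (q.eval₂ (algebraMap S E) y) < 1) →
      Nonempty OE.valuation.RankOne →
      ∀ (M : Subfield E), (∀ s : S, algebraMap S E s ∈ M) →
      ∀ (N : IntermediateField M E) [FiniteDimensional M N] [IsGalois M N] (K' : Subfield E),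
        M ≤ K' → K' ≤ (lift (fixedField (inertiaGroupIn OE N))).toSubfield →
        (∃ t : Finset E, (t : Set E) ⊆ K' ∧
          K' ≤ Subfield.closure (Set.range (algebraMap S E) ∪ (t : Set E)) ∧
          ∃ hTO : (Algebra.adjoin S (t : Set E)).toSubring ≤ OE.toSubring,
            IsRegularLocalRing (Localization.AtPrime
              (Ideal.comap (Subring.inclusion hTO) (maximalIdeal OE)))) →
        (∃ t : Finset E, (t : Set E) ⊆ M ∧
          M ≤ Subfield.closure (Set.range (algebraMap S E) ∪ (t : Set E)) ∧
          ∃ hTO : (Algebra.adjoin S (t : Set E)).toSubring ≤ OE.toSubring,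
            IsRegularLocalRing (Localization.AtPrime
              (Ideal.comap (Subring.inclusion hTO) (maximalIdeal OE))))) :
    CossartPiltant2019ReductionP.{u} :=
  cossartPiltant2019ReductionP_of_cjs_of_descent hloc h44 hCJS hEmb
    (fun p hp S _ _ _ hS hSdim hSchar hScomp E _ _ hinj hE halg OE hSO hdom hres hrk M hSM N _ _ K'
        hMK' hK'r hLUK' => by
      haveI := hE
      haveI := halg
      exact descent_below_ramificationField_of_steps p hp hSchar OE hSO hdom
        (cofinality_of_principalization h44 p hp S hS hSdim hSchar hScomp E hinj hE halg OE hSO hdom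
          hres)
        (hStep p hp S hS hSdim hSchar hScomp E hinj hE halg OE hSO hdom hres hrk)
        (fun M' hSM' N' _ _ => hUnram p hp S hS hSdim hSchar hScomp E hinj hE halg OE hSO hdom hres
          hrk M' hSM' N')
        M hSM N K' hMK' hK'r hLUK')

end Literature.AlgebraicGeometry.Resolution

end
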